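import Summits.QuantumFields.BalabanUV.Beta.GAN24.WSlotFirstDiff
import Summits.QuantumFields.BalabanUV.Beta.MixedJetTablesPlug

/-!
# `BalabanUV.Beta.GAN24.WSlotDiffShape` — binder row G-an2-4 / (CONV-C), W-slot, road «W3»: THE SHAPE OF EVERY ONE-STEP DIFFERENCE
# `D♮_j = T♮_{j+1} − T♮_j` OF an2's NORMALISED STAGE-B FAMILY AT A FIXED LEVEL `j` — the shape binder `h1` of the re-cut END #2′ (R1) at its
# new head `D♮₁ = T♮₂ − T♮₁`, and its `j = 0` / any-`j` / any-root companions (G-an2-4 FORMAL swarm, leaf-01 lineage, gen 16; «W3-DIFF-SHAPE-J*»)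

NOT IN PRINT; OUR BOOKKEEPING.  HONEST FRAMING (cell contract, verbatim): «discharging `BetaPertH` makes Bałaban's UV stability
UNCONDITIONAL — a real constructive-QFT result; it is NOT the continuum limit and NOT the Clay problem.»  HONEST DEPENDENCY (verbatim):
«continuum YM on T⁴ ⇐ BetaPertH ∧ nine spine estimates (0/9 proved); BetaPertH ⇐ (D1) ∧ (D4) ∧ CAP+tail; G-an2-4 gates asym, D1 and
NE2/3/4.»

WHY.  Referee 2's round 61 (R61-2 (b)) makes the «unroll from `D₁`» repair (R1) of END #2 `WSlotT2OfPieces.rate_of_rows` / `t2Drift_of_rows`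
(p213240) the re-cut OF RECORD: the difference tower is unrolled from its member `D♮₁ = T♮₂ − T♮₁` (binders `h1` = shape ∧ moment of `D♮₁`,
`hZ1` = its zero mode; member `0` absorbed by a shape binder `h00`).  In the tree: `hsplit` from level 1 = `T2UnitSplitFrom` (p214222) /
`T2UnitSplitFromRoot` (p214503); `hZ1` = leaf-18's `ChargeStepSymD1.hZ1_three` (exact pin); `h00` = leaf-07's `WSlotFirstDiff.hD0_shape` /
`hD0_pair`, which are stated at the levels `0, 1` ONLY (leaf-18's composed `WSlotT2DriftFromOneThree` p214697 takes `h1` from END #1's «T2Shape»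
output instead).  This module supplies the SHAPE binder at the new head UNCONDITIONALLY (member-wise, no «T2Shape», no pin, no zero mode) and,
once and for all, at EVERY fixed level `j` and every border — leaf-07's three proofs with `0, 1 ↦ j, j+1` (his `locStencil₂_unitS₂` + an2's member-wise
`BalabanStepW2.T2Of_loc` BY NAME; a single step needs NO `j`-uniformity):
* §1 GENERIC LEVEL `j`, GENERIC BORDER `Bd` under its shape binder `hB` (any root for free): `shape_succ_pair` (members `j`, `j+1` at one common
  positive rate), **`hDiff_shape`** (`∃ C δ₀, 0 < δ₀ ∧ 0 ≤ C ∧ ∀ δ ≤ δ₀, LocStencil₂ (T♮_{j+1} − T♮_j) C δ`), `hDiff_pair` (+ the `mom := fun _ ↦ 0`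
  conjunct of the ENDs' instantiation of record, ref2 R57-2 (b));
* §2 an1's BASE-root border `vh₂S d Lc` (the ENDs' literal tables): `hDiff_pair_vh₂S` (any `j`) and THE `j = 1` NUMERALS **`hD1_shape`**, **`hD1_pair`**
  (levels `2`, `1` literally — the `h1` binder text of END #2′ for `exact`; `j = 0` is leaf-07's `hD0_shape` / `hD0_pair`, not restated);
* §3 an1's border of ANY box root `r` with both an1 tables (`MixedJetTablesPlug.hB_an1` / `hmix_an1` BY NAME): `hDiff_pair_an1` (any `j`),
  `hD1_pair_an1`.
[folklore] member-wise shapes with per-level EXISTENTIAL constants; asserts NO `j`-uniform bound («T2Shape» is END #1's conclusion, OPEN ⇐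
{ROW W3-F2a, hpin} per ref2 r59), NO zero mode, NO sum rule, NO estimate of Bałaban's; discharges NOTHING of «T2SupRate»/«T2Drift»/(hW₂, hW₂all);
instantiates NO wall binder (the D1 wall's K 2/2 and S 2/2 binder pairs are tree theorems at d = 3, Lc ≥ 2; W 0/2 — this module: none);
NOT «W-slot closed», NEVER «G-an2-4 closed»; NOT BetaPertH, NOT continuum, NOT Clay.  One-shot INPUT lemma, not a LEAVES row; yields to the
F4d holder lineage leaf-07 and to the row owner gan24-p1 (rename / absorb welcome).
-/

noncomputable section

open Finset
open scoped BigOperators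
open Literature.MathematicalPhysics.QuantumFieldTheory
open Literature.MathematicalPhysics.QuantumFieldTheory.Balaban1983to89
open Literature.MathematicalPhysics.QuantumFieldTheory.Balaban1983to89.Beta
open Literature.MathematicalPhysics.QuantumFieldTheory.Balaban1983to89.Beta.AffineAveraging (box toSite)
open ExpKernelCalculus (MKer)
open OneStepResolventKernel (Fib)
open BalabanCompositeJets (LocStencil₂)
open SecondOrderResponse (LocStencilFM)
open BalabanStepW2 (T2Of T2Of_loc locStencil₂_smul' locStencil₂_add')
open AveragingMixedJetTables (vh₂S vh₂SAt mixFFAt)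
open Summit.QuantumFields.BalabanUV.Beta.SecondOrderUnits (unitS₂)
open Summit.QuantumFields.BalabanUV.Beta.MixedJetTablesPlug (hB_an1 hmix_an1)
open Summit.QuantumFields.BalabanUV.Beta.GAN24.CombesThomas (sfStep smStep)
open Summit.QuantumFields.BalabanUV.Beta.GAN24.T2SlotUnits (locStencil₂_vh₂S)
open Summit.QuantumFields.BalabanUV.Beta.GAN24.WSlotFirstDiff (locStencil₂_unitS₂)

namespace Summit.QuantumFields.BalabanUV.Beta.GAN24.WSlotDiffShape

variable {d : ℕ}

/-! ## §1 Generic level `j`, generic border `Bd`: members `j`, `j+1` and their difference at one common rate -/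

section Border

variable {Lc : ℕ} [NeZero Lc]

/-- [folklore] **MEMBERS `j` AND `j+1` OF THE NORMALISED FAMILY AT ONE COMMON POSITIVE RATE**, generic border `Bd` under its shape binder `hB`
(an2's member-wise `T2Of_loc` at `j`, `j+1`, transported through `unitS₂` by leaf-07's `WSlotFirstDiff.locStencil₂_unitS₂`; `min` of the two rates). -/
theorem shape_succ_pair (hLc : 1 ≤ Lc) (cE cVH cΛ cE₂ cB : ℝ) (Tc : Fin 4 → Fin 4 → Fin 4 → Fin 4 → ℝ)
    {Bd : Fin (d + 1) → (Fin (d + 1) → ℤ) → Fin (d + 1) → (Fin (d + 1) → ℤ) → MKer (d + 1) (Fib d)}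
    (hB : ∃ C δ : ℝ, 0 < δ ∧ LocStencil₂ Bd C δ)
    {mixFF : Fin (d + 1) → (Fin (d + 1) → ℤ) → Fin (d + 1) → (Fin (d + 1) → ℤ) → MKer (d + 1) (Fib d)}
    (hmix : ∃ C δ : ℝ, 0 < δ ∧ LocStencilFM Lc mixFF C δ) (j : ℕ) :
    ∃ C₀ C₁ δ₀ : ℝ, 0 < δ₀ ∧ 0 ≤ C₀ ∧ 0 ≤ C₁ ∧
      LocStencil₂ (unitS₂ (sfStep Lc j) (smStep d Lc j) (T2Of d Lc cE cVH cΛ cE₂ cB Tc Bd mixFF j)) C₀ δ₀ ∧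
      LocStencil₂ (unitS₂ (sfStep Lc (j + 1)) (smStep d Lc (j + 1)) (T2Of d Lc cE cVH cΛ cE₂ cB Tc Bd mixFF (j + 1))) C₁ δ₀ := by
  obtain ⟨A₀, δa, hδa, h₀⟩ := T2Of_loc hLc cE cVH cΛ cE₂ cB Tc hB hmix j
  obtain ⟨A₁, δb, hδb, h₁⟩ := T2Of_loc hLc cE cVH cΛ cE₂ cB Tc hB hmix (j + 1)
  have u0 := locStencil₂_unitS₂ (sfStep Lc j) (smStep d Lc j) h₀
  have u1 := locStencil₂_unitS₂ (sfStep Lc (j + 1)) (smStep d Lc (j + 1)) h₁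
  exact ⟨_, _, min δa δb, lt_min hδa hδb, u0.nonneg, u1.nonneg, u0.mono (min_le_left _ _), u1.mono (min_le_right _ _)⟩

/-- **THE SHAPE OF THE ONE-STEP DIFFERENCE `D♮_j = T♮_{j+1} − T♮_j` AT A FIXED LEVEL `j`** [folklore], generic border `Bd` under `hB`: SOME
constant `C ≥ 0` and SOME rate `δ₀ > 0` work, and then every rate `δ ≤ δ₀` (the END takes its own `δin ≤ δ₀`).  Leaf-07's `hD0_shape` is the case
`j = 0`, `Bd = vh₂S d Lc`. -/
theorem hDiff_shape (hLc : 1 ≤ Lc) (cE cVH cΛ cE₂ cB : ℝ) (Tc : Fin 4 → Fin 4 → Fin 4 → Fin 4 → ℝ)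
    {Bd : Fin (d + 1) → (Fin (d + 1) → ℤ) → Fin (d + 1) → (Fin (d + 1) → ℤ) → MKer (d + 1) (Fib d)}
    (hB : ∃ C δ : ℝ, 0 < δ ∧ LocStencil₂ Bd C δ)
    {mixFF : Fin (d + 1) → (Fin (d + 1) → ℤ) → Fin (d + 1) → (Fin (d + 1) → ℤ) → MKer (d + 1) (Fib d)}
    (hmix : ∃ C δ : ℝ, 0 < δ ∧ LocStencilFM Lc mixFF C δ) (j : ℕ) :
    ∃ C δ₀ : ℝ, 0 < δ₀ ∧ 0 ≤ C ∧ ∀ δ : ℝ, δ ≤ δ₀ →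
      LocStencil₂ (fun κ u κ' u' =>
        unitS₂ (sfStep Lc (j + 1)) (smStep d Lc (j + 1)) (T2Of d Lc cE cVH cΛ cE₂ cB Tc Bd mixFF (j + 1)) κ u κ' u'
          - unitS₂ (sfStep Lc j) (smStep d Lc j) (T2Of d Lc cE cVH cΛ cE₂ cB Tc Bd mixFF j) κ u κ' u') C δ := by
  obtain ⟨C₀, C₁, δ₀, hδ₀, hC₀, hC₁, h₀, h₁⟩ := shape_succ_pair hLc cE cVH cΛ cE₂ cB Tc hB hmix j
  refine ⟨C₁ + |(-1 : ℝ)| * C₀, δ₀, hδ₀, by positivity, fun δ hδ => ?_⟩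
  have e : (fun κ u κ' u' =>
        unitS₂ (sfStep Lc (j + 1)) (smStep d Lc (j + 1)) (T2Of d Lc cE cVH cΛ cE₂ cB Tc Bd mixFF (j + 1)) κ u κ' u'
          - unitS₂ (sfStep Lc j) (smStep d Lc j) (T2Of d Lc cE cVH cΛ cE₂ cB Tc Bd mixFF j) κ u κ' u')
      = fun κ u κ' u' =>
        unitS₂ (sfStep Lc (j + 1)) (smStep d Lc (j + 1)) (T2Of d Lc cE cVH cΛ cE₂ cB Tc Bd mixFF (j + 1)) κ u κ' u'
          + (-1 : ℝ) • unitS₂ (sfStep Lc j) (smStep d Lc j) (T2Of d Lc cE cVH cΛ cE₂ cB Tc Bd mixFF j) κ u κ' u' := by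
    funext κ u κ' u'
    rw [neg_one_smul, sub_eq_add_neg]
  rw [e]
  exact locStencil₂_add' (h₁.mono hδ) (locStencil₂_smul' (-1) (h₀.mono hδ))

/-- **THE END's SHAPE PAIR FOR `D♮_j` at `mom := fun _ ↦ 0`** [folklore] (the instantiation of record, ref2 R57-2 (b)): for every `δ ≤ δ₀`,
`LocStencil₂ D♮_j C δ ∧ (fun _ ↦ (0:ℝ)) D♮_j ≤ C` — the shape of END #2's `h0` / END #2′'s `h1`, `h00` binders at a general level and border. -/
theorem hDiff_pair (hLc : 1 ≤ Lc) (cE cVH cΛ cE₂ cB : ℝ) (Tc : Fin 4 → Fin 4 → Fin 4 → Fin 4 → ℝ)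
    {Bd : Fin (d + 1) → (Fin (d + 1) → ℤ) → Fin (d + 1) → (Fin (d + 1) → ℤ) → MKer (d + 1) (Fib d)}
    (hB : ∃ C δ : ℝ, 0 < δ ∧ LocStencil₂ Bd C δ)
    {mixFF : Fin (d + 1) → (Fin (d + 1) → ℤ) → Fin (d + 1) → (Fin (d + 1) → ℤ) → MKer (d + 1) (Fib d)}
    (hmix : ∃ C δ : ℝ, 0 < δ ∧ LocStencilFM Lc mixFF C δ) (j : ℕ) :
    ∃ C δ₀ : ℝ, 0 < δ₀ ∧ ∀ δ : ℝ, δ ≤ δ₀ →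
      LocStencil₂ (fun κ u κ' u' =>
        unitS₂ (sfStep Lc (j + 1)) (smStep d Lc (j + 1)) (T2Of d Lc cE cVH cΛ cE₂ cB Tc Bd mixFF (j + 1)) κ u κ' u'
          - unitS₂ (sfStep Lc j) (smStep d Lc j) (T2Of d Lc cE cVH cΛ cE₂ cB Tc Bd mixFF j) κ u κ' u') C δ ∧
      (fun _ : Fin (d + 1) → (Fin (d + 1) → ℤ) → Fin (d + 1) → (Fin (d + 1) → ℤ) → MKer (d + 1) (Fib d) => (0 : ℝ))
        (fun κ u κ' u' =>
          unitS₂ (sfStep Lc (j + 1)) (smStep d Lc (j + 1)) (T2Of d Lc cE cVH cΛ cE₂ cB Tc Bd mixFF (j + 1)) κ u κ' u'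
            - unitS₂ (sfStep Lc j) (smStep d Lc j) (T2Of d Lc cE cVH cΛ cE₂ cB Tc Bd mixFF j) κ u κ' u') ≤ C := by
  obtain ⟨C, δ₀, hδ₀, hC, h⟩ := hDiff_shape hLc cE cVH cΛ cE₂ cB Tc hB hmix j
  exact ⟨C, δ₀, hδ₀, fun δ hδ => ⟨h δ hδ, hC⟩⟩

end Border

/-! ## §2 an1's base-root border `vh₂S d Lc` (the ENDs' literal tables): any level `j`, and the `j = 1` numerals of END #2′'s head `D♮₁` -/

section BaseRoot

variable {Lc : ℕ} [NeZero Lc]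

/-- [folklore] **THE END's SHAPE PAIR FOR `D♮_j` AT THE BASE ROOT**, any fixed level `j`, modulo `hmix` only (border shape by leaf-19's
`T2SlotUnits.locStencil₂_vh₂S`).  `j = 0` is leaf-07's `WSlotFirstDiff.hD0_pair` (the END's `h0` / END #2′'s `h00`). -/
theorem hDiff_pair_vh₂S (hLc : 1 ≤ Lc) (cE cVH cΛ cE₂ cB : ℝ) (Tc : Fin 4 → Fin 4 → Fin 4 → Fin 4 → ℝ)
    {mixFF : Fin (d + 1) → (Fin (d + 1) → ℤ) → Fin (d + 1) → (Fin (d + 1) → ℤ) → MKer (d + 1) (Fib d)}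
    (hmix : ∃ C δ : ℝ, 0 < δ ∧ LocStencilFM Lc mixFF C δ) (j : ℕ) :
    ∃ C δ₀ : ℝ, 0 < δ₀ ∧ ∀ δ : ℝ, δ ≤ δ₀ →
      LocStencil₂ (fun κ u κ' u' =>
        unitS₂ (sfStep Lc (j + 1)) (smStep d Lc (j + 1)) (T2Of d Lc cE cVH cΛ cE₂ cB Tc (vh₂S d Lc) mixFF (j + 1)) κ u κ' u'
          - unitS₂ (sfStep Lc j) (smStep d Lc j) (T2Of d Lc cE cVH cΛ cE₂ cB Tc (vh₂S d Lc) mixFF j) κ u κ' u') C δ ∧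
      (fun _ : Fin (d + 1) → (Fin (d + 1) → ℤ) → Fin (d + 1) → (Fin (d + 1) → ℤ) → MKer (d + 1) (Fib d) => (0 : ℝ))
        (fun κ u κ' u' =>
          unitS₂ (sfStep Lc (j + 1)) (smStep d Lc (j + 1)) (T2Of d Lc cE cVH cΛ cE₂ cB Tc (vh₂S d Lc) mixFF (j + 1)) κ u κ' u'
            - unitS₂ (sfStep Lc j) (smStep d Lc j) (T2Of d Lc cE cVH cΛ cE₂ cB Tc (vh₂S d Lc) mixFF j) κ u κ' u') ≤ C :=
  hDiff_pair hLc cE cVH cΛ cE₂ cB Tc ⟨_, 1, one_pos, locStencil₂_vh₂S hLc zero_le_one⟩ hmix j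

/-- **THE SHAPE BINDER `h1` OF THE RE-CUT END #2′ (R1) — `D♮₁ = T♮₂ − T♮₁`, SHAPE HALF** [folklore]: SOME `C₁ ≥ 0` and SOME rate `δ₁ > 0`
work, and then every rate `δ ≤ δ₁`; levels `2`, `1` LITERALLY (the `j = 1` numerals of `hDiff_shape` at the base root).  The `j = 0` twin is
leaf-07's `WSlotFirstDiff.hD0_shape`. -/
theorem hD1_shape (hLc : 1 ≤ Lc) (cE cVH cΛ cE₂ cB : ℝ) (Tc : Fin 4 → Fin 4 → Fin 4 → Fin 4 → ℝ)
    {mixFF : Fin (d + 1) → (Fin (d + 1) → ℤ) → Fin (d + 1) → (Fin (d + 1) → ℤ) → MKer (d + 1) (Fib d)}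
    (hmix : ∃ C δ : ℝ, 0 < δ ∧ LocStencilFM Lc mixFF C δ) :
    ∃ C₁ δ₁ : ℝ, 0 < δ₁ ∧ 0 ≤ C₁ ∧ ∀ δ : ℝ, δ ≤ δ₁ →
      LocStencil₂ (fun κ u κ' u' =>
        unitS₂ (sfStep Lc 2) (smStep d Lc 2) (T2Of d Lc cE cVH cΛ cE₂ cB Tc (vh₂S d Lc) mixFF 2) κ u κ' u'
          - unitS₂ (sfStep Lc 1) (smStep d Lc 1) (T2Of d Lc cE cVH cΛ cE₂ cB Tc (vh₂S d Lc) mixFF 1) κ u κ' u') C₁ δ :=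
  hDiff_shape hLc cE cVH cΛ cE₂ cB Tc ⟨_, 1, one_pos, locStencil₂_vh₂S hLc zero_le_one⟩ hmix 1

/-- **THE `h1` PAIR OF THE RE-CUT END #2′ at `mom := fun _ ↦ 0`** [folklore]: for every `δ ≤ δ₁`, `LocStencil₂ D♮₁ C₁ δ ∧ (fun _ ↦ (0:ℝ)) D♮₁ ≤ C₁`,
levels `2`, `1` literally.  The `j = 0` twin (END #2′'s `h00` / END #2's `h0`) is leaf-07's `WSlotFirstDiff.hD0_pair`. -/
theorem hD1_pair (hLc : 1 ≤ Lc) (cE cVH cΛ cE₂ cB : ℝ) (Tc : Fin 4 → Fin 4 → Fin 4 → Fin 4 → ℝ)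
    {mixFF : Fin (d + 1) → (Fin (d + 1) → ℤ) → Fin (d + 1) → (Fin (d + 1) → ℤ) → MKer (d + 1) (Fib d)}
    (hmix : ∃ C δ : ℝ, 0 < δ ∧ LocStencilFM Lc mixFF C δ) :
    ∃ C₁ δ₁ : ℝ, 0 < δ₁ ∧ ∀ δ : ℝ, δ ≤ δ₁ →
      LocStencil₂ (fun κ u κ' u' =>
        unitS₂ (sfStep Lc 2) (smStep d Lc 2) (T2Of d Lc cE cVH cΛ cE₂ cB Tc (vh₂S d Lc) mixFF 2) κ u κ' u'
          - unitS₂ (sfStep Lc 1) (smStep d Lc 1) (T2Of d Lc cE cVH cΛ cE₂ cB Tc (vh₂S d Lc) mixFF 1) κ u κ' u') C₁ δ ∧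
      (fun _ : Fin (d + 1) → (Fin (d + 1) → ℤ) → Fin (d + 1) → (Fin (d + 1) → ℤ) → MKer (d + 1) (Fib d) => (0 : ℝ))
        (fun κ u κ' u' =>
          unitS₂ (sfStep Lc 2) (smStep d Lc 2) (T2Of d Lc cE cVH cΛ cE₂ cB Tc (vh₂S d Lc) mixFF 2) κ u κ' u'
            - unitS₂ (sfStep Lc 1) (smStep d Lc 1) (T2Of d Lc cE cVH cΛ cE₂ cB Tc (vh₂S d Lc) mixFF 1) κ u κ' u') ≤ C₁ :=
  hDiff_pair_vh₂S hLc cE cVH cΛ cE₂ cB Tc hmix 1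

end BaseRoot

/-! ## §3 an1's border of ANY box root `r`, both an1 tables: any level `j`, and the `j = 1` numerals -/

section An1

variable {Lc : ℕ} [NeZero Lc] {r : Fin (d + 1) → ℕ}

/-- [folklore] **THE END's SHAPE PAIR FOR `D♮_j` WITH an1's TABLES `vh₂SAt (toSite r) Lc`, `mixFFAt (toSite r) Lc` OF ANY BOX ROOT `r` PLUGGED
IN — NO TABLE HYPOTHESIS** (`MixedJetTablesPlug.hB_an1` / `hmix_an1` BY NAME), any fixed level `j`; residual binders `1 ≤ Lc`, `r ∈ box (d+1) Lc`. -/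
theorem hDiff_pair_an1 (hLc : 1 ≤ Lc) (hr : r ∈ box (d + 1) Lc) (cE cVH cΛ cE₂ cB : ℝ) (Tc : Fin 4 → Fin 4 → Fin 4 → Fin 4 → ℝ) (j : ℕ) :
    ∃ C δ₀ : ℝ, 0 < δ₀ ∧ ∀ δ : ℝ, δ ≤ δ₀ →
      LocStencil₂ (fun κ u κ' u' =>
        unitS₂ (sfStep Lc (j + 1)) (smStep d Lc (j + 1))
            (T2Of d Lc cE cVH cΛ cE₂ cB Tc (vh₂SAt (toSite r) Lc) (mixFFAt (toSite r) Lc) (j + 1)) κ u κ' u'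
          - unitS₂ (sfStep Lc j) (smStep d Lc j) (T2Of d Lc cE cVH cΛ cE₂ cB Tc (vh₂SAt (toSite r) Lc) (mixFFAt (toSite r) Lc) j) κ u κ' u') C δ ∧
      (fun _ : Fin (d + 1) → (Fin (d + 1) → ℤ) → Fin (d + 1) → (Fin (d + 1) → ℤ) → MKer (d + 1) (Fib d) => (0 : ℝ))
        (fun κ u κ' u' =>
          unitS₂ (sfStep Lc (j + 1)) (smStep d Lc (j + 1))
              (T2Of d Lc cE cVH cΛ cE₂ cB Tc (vh₂SAt (toSite r) Lc) (mixFFAt (toSite r) Lc) (j + 1)) κ u κ' u'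
            - unitS₂ (sfStep Lc j) (smStep d Lc j) (T2Of d Lc cE cVH cΛ cE₂ cB Tc (vh₂SAt (toSite r) Lc) (mixFFAt (toSite r) Lc) j) κ u κ' u')
          ≤ C :=
  hDiff_pair hLc cE cVH cΛ cE₂ cB Tc (hB_an1 hLc hr) (hmix_an1 hLc hr) j

/-- **THE `h1` PAIR OF THE RE-CUT END #2′ WITH an1's TABLES OF ANY BOX ROOT `r` — NO TABLE HYPOTHESIS** [folklore]: levels `2`, `1` literally. -/
theorem hD1_pair_an1 (hLc : 1 ≤ Lc) (hr : r ∈ box (d + 1) Lc) (cE cVH cΛ cE₂ cB : ℝ) (Tc : Fin 4 → Fin 4 → Fin 4 → Fin 4 → ℝ) :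
    ∃ C₁ δ₁ : ℝ, 0 < δ₁ ∧ ∀ δ : ℝ, δ ≤ δ₁ →
      LocStencil₂ (fun κ u κ' u' =>
        unitS₂ (sfStep Lc 2) (smStep d Lc 2) (T2Of d Lc cE cVH cΛ cE₂ cB Tc (vh₂SAt (toSite r) Lc) (mixFFAt (toSite r) Lc) 2) κ u κ' u'
          - unitS₂ (sfStep Lc 1) (smStep d Lc 1) (T2Of d Lc cE cVH cΛ cE₂ cB Tc (vh₂SAt (toSite r) Lc) (mixFFAt (toSite r) Lc) 1) κ u κ' u') C₁ δ ∧
      (fun _ : Fin (d + 1) → (Fin (d + 1) → ℤ) → Fin (d + 1) → (Fin (d + 1) → ℤ) → MKer (d + 1) (Fib d) => (0 : ℝ))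
        (fun κ u κ' u' =>
          unitS₂ (sfStep Lc 2) (smStep d Lc 2) (T2Of d Lc cE cVH cΛ cE₂ cB Tc (vh₂SAt (toSite r) Lc) (mixFFAt (toSite r) Lc) 2) κ u κ' u'
            - unitS₂ (sfStep Lc 1) (smStep d Lc 1) (T2Of d Lc cE cVH cΛ cE₂ cB Tc (vh₂SAt (toSite r) Lc) (mixFFAt (toSite r) Lc) 1) κ u κ' u')
          ≤ C₁ :=
  hDiff_pair_an1 hLc hr cE cVH cΛ cE₂ cB Tc 1

end An1

end Summit.QuantumFields.BalabanUV.Beta.GAN24.WSlotDiffShape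

end
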